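import Literature.AnabelianGeometry.AbsoluteAnabelian.HolomorphicEllipticCuspidalization
import Literature.GroupTheory.CombinatorialGroupTheory.FreeProductThreeInvolutions
import HarnessLib

/-!
# [AbsTopIII] Cor. 2.7 (a), sub-node (a).1: `IndexTwoTorsionFreeUnique` — DISCHARGED (proof-only companion)

Topic `AnabelianGeometry/AbsoluteAnabelian`; proof-only companion of abc-iut-L4-t12's sub-DAG statements file
`HolomorphicEllipticCuspidalization.lean` (p414370; plan/L4/SUBDAG-AbsTopIII-Cor-27.md row Cor-27.a.r2). The typed
sub-node `IndexTwoTorsionFreeUnique` («the unique torsion-free subgroup of index two of the group Π», [AbsTopIII] Cor.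
2.7 (a) p.58 / [AbsTopII] Rmk 3.1.1: `ℤ/2 ∗ ℤ/2 ∗ ℤ/2` has exactly one torsion-free subgroup of index two) is, verbatim,
the classical theorem `Literature.GroupTheory.CombinatorialGroupTheory.existsUnique_index_two_torsionFree`
(FreeProductThreeInvolutions.lean, abc-iut-w5-d104): this file records the one-line discharge with the fully-qualified
type. No definition, no named fact; nothing of the statements file is restated. HONEST FRAMING: a classical
group-theoretic step of a refereed paper ([AbsTopIII]); nothing here bears on [IUTchIII] Cor. 3.12.
-/

namespace Literature.AnabelianGeometry.AbsoluteAnabelian.HolomorphicEllipticCuspidalization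

/-- **[AbsTopIII] Cor. 2.7 (a), sub-node (a).1 DISCHARGED**: the free product of three groups of order two has
exactly one torsion-free subgroup of index two. [cite: MochizukiAbsTopIII2015, Corollary 2.7 (a) p.58] -/
theorem indexTwoTorsionFreeUnique_holds :
    Literature.AnabelianGeometry.AbsoluteAnabelian.HolomorphicEllipticCuspidalization.IndexTwoTorsionFreeUnique :=
  Literature.GroupTheory.CombinatorialGroupTheory.existsUnique_index_two_torsionFree

/-- `IndexTwoTorsionFreeUnique` — `_holds` alias of `indexTwoTorsionFreeUnique_holds` above under the fact's exact name (appended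
2026-08-28, D-0026 bookkeeping: the proof term is the existing theorem of this file; no statement,
definition or attribute is edited; no new named fact; the ledger's debt table listed the fact
unproved). [cite: MochizukiAbsTopIII2015, Corollary 2.7 (a) p.58] -/
theorem _root_.Literature.AnabelianGeometry.AbsoluteAnabelian.HolomorphicEllipticCuspidalization.IndexTwoTorsionFreeUnique_holds :
    Literature.AnabelianGeometry.AbsoluteAnabelian.HolomorphicEllipticCuspidalization.IndexTwoTorsionFreeUnique :=
  _root_.Literature.AnabelianGeometry.AbsoluteAnabelian.HolomorphicEllipticCuspidalization.indexTwoTorsionFreeUnique_holds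

end Literature.AnabelianGeometry.AbsoluteAnabelian.HolomorphicEllipticCuspidalization
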